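/-
Copyright (c) 2026 the pub-hodgecm-mathlib formalisation cell (harness21).  Prover seat hodgecm-mathlib-K2E3-p17 (g6), Track B «K2-LIT» ∕ h413
(`stmt-HodgeConjecture-24833`), line `K2_E3_EllipticInputs`, unit U12 §L, Richardson road for (LBGL-ge3) at `N = 3` (road owner K2E3-p11),
brick (F-J) = (S-B♭)_Lie, FILE G2 «THE `K × N₃`-ORBITAL PULLBACK THROUGH THE ORBIT CHART, UNIFORMLY OVER THE WEYL TRANSLATES».  2026-09-04.
-/
import Summits.HodgeConjecture.HodgeConjecture.Theorems.K2E3GL3OrbitChartStabilisers     -- ★ p857658 (this seat, G1): who conjugates `diagonal (d+z)` into `V_k(t)`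
import Summits.HodgeConjecture.HodgeConjecture.Theorems.K2E3GL3RegularDiagonalOrbitChart  -- ★ p857634 (this seat, E2): `continuous_orbitChart`, boxes
import Summits.HodgeConjecture.HodgeConjecture.Theorems.K2E3GL3UpperSliceFubini            -- ★ p857616 (K2E3-p03, A2): instance kit for `K × N₃` (`t2Space_generalLinearGroup`, `isClosed_unipotentRadicalGL` via its imports)
import Mathlib.MeasureTheory.Constructions.BorelSpace.Basic
import HarnessLib

/-!
# K2_E3 road (h413), §L ∕ Richardson road at `N = 3`, brick (F-J) FILE G2: the `K × N₃`-orbital integral of `1_{V_k(t)}·h` at `s = diagonal (d + z)` PULLS BACK through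
# the orbit chart — GIVEN the level-`k` product formula (IMF) — and the answer does not see the Weyl translate `m`

Cell `pub/hodgecm-mathlib` (D-0151), Track B, seat K2E3-p17 (g6), deal (D60) = (F-J) (road owner K2E3-p11; census `K2/K2E3-p17/g6/CENSUS-SBflatLie-N3.K2E3-p17-g6.md` §1 (iv),
brick G).  `--supports stmt-HodgeConjecture-24833 --as helper`; THEOREMS ONLY (no definition ∕ instance ∕ notation ∕ named fact ∕ `sorry`); never imports `Cruxes/…/Lines`.
COUNT-NEUTRAL.

THE RESULT (**`lintegral_prod_indicator_image_orbitChart_eq`**).  `K = GL₃(𝒪)` (★ `glInt`), `N = N₃(F)` (★ `unipotentRadicalGL F id`), Haar measures `κ`, `μN`; `t = diagonal d`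
SEPARATED at level `k` (`q^{-k} < ‖d_i − d_j‖`), `z ∈ (𝔭^k)³`, `s = diagonal (d + z)`; `V = Ψ_t(M₃(𝔭^k))` the image of the orbit chart (★ E1∕E2); `m ∈ K` normalising the torus
(`Ad(m)(diagonal) = diagonal` — the permutation matrices).  ASSUME the level-`k` product formula (IMF) of ★ F2b for `(κ, μ𝔤, dx)` with constant `c` (hypothesis `hIMF`:
this file does not import F2b).  Then for every measurable `h ≥ 0`,
  `dx(𝔭^k)³ · ∫⁻_{K×N} (1_V·h)(Ad(k' n m) s) d(κ⊗μN) = μN(N(𝒪)) · c · ∫⁻_{X ∈ M₃(𝔭^k)} h(Ψ_t(X⁺ + X⁻ + diagonal z)) dμ𝔤`.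
PROOF.  ★ G1: `Ad(k' n m) s ∈ V` forces `n ∈ N(𝒪)` and then `k' n m ∈ K` has off-diagonal entries in `𝔭^k`; Tonelli over `n` + RIGHT-INVARIANCE of `κ` under `n m ∈ K` (compact
groups are unimodular, ★ `HaarLocalChart`) ⇒ `μN(N(𝒪)) · ∫⁻_K (1_V·h)(Ad(k') s) dκ`; the integrand `Θ(Y) = (1_V·h)(Y s Y⁻¹)` is right-`A(𝒪)`-invariant (the torus centralises `s`) and
vanishes off `{off-diag ∈ 𝔭^k}`, so (IMF) applies; finally `Θ((1+X⁺)(1+X⁻)) = h(Ψ_t(X⁺ + X⁻ + diagonal z))` by ★ E1 `exists_orbitChart_eq_conj`.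
[HarishChandra1999AdmissibleDistributions, Lemma 7.8] [HarishChandra1970, Part V §4 Lemma 22] [Helgason2000, Ch. I §1 Thm. 1.14]
HONEST LABEL: HC_CM is proved only modulo the 7 printed citations (2 remaining named inputs: hLiu418 = stmt-HodgeConjecture-24832, h413 = stmt-HodgeConjecture-24833)
until rung 0 closes; count-neutral helper ((LBGL-ge3)∕(LBGL-3J) NOT ★ here).

## References
* [HarishChandra1999AdmissibleDistributions] Harish-Chandra (DeBacker–Sally), *Admissible Invariant Distributions on Reductive p-adic Groups* (1999), §7, Lemma 7.8.
* [HarishChandra1970] Harish-Chandra (van Dijk), *Harmonic Analysis on Reductive p-adic Groups*, LNM 162 (1970), Part V §4 Lemma 22.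
* [Helgason2000] S. Helgason, *Groups and Geometric Analysis* (2000), Ch. I §1 Thm. 1.14 (compact groups are unimodular).
-/

set_option autoImplicit false
set_option linter.dupNamespace false

noncomputable section

open MeasureTheory Measure Filter Topology Set Matrix ValuativeRel
open scoped MatrixGroups NNReal ENNReal Valued
open Literature.NumberTheory.Automorphic Literature.NumberTheory.Automorphic.LocalFieldHaar
open Literature.NumberTheory.GaloisRepresentations Literature.NumberTheory.GaloisRepresentations.IsNonarchimedeanLocalField
open Summit.HodgeConjecture.HodgeConjecture.Cruxes.H413.K2E3GL3OrbitChartDeriv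
open Summit.HodgeConjecture.HodgeConjecture.Cruxes.H413.K2E3GL3OrbitChartStabilisers
open Summit.HodgeConjecture.HodgeConjecture.Cruxes.H413.K2E3GL3RegularDiagonalOrbitChart

namespace Summit.HodgeConjecture.HodgeConjecture.Cruxes.H413.K2E3GL3KNOrbitalLocalPullback

variable {F : Type*} [Field F] [ValuativeRel F] [TopologicalSpace F] [IsNonarchimedeanLocalField F]

/-! ## §1  For `k' ∈ K`: `Ad(k') s ∈ V_k(t)` forces all off-diagonal entries of `k'` into `𝔭^k` -/

/-- **`Ad(k') s ∈ V_k(t)` with `k' ∈ K` ⇒ off-diag(`k'`) `∈ 𝔭^k`** (`k' = g·a`, `g = (1+X⁺)(1+X⁻)` with off-diagonal entries in `𝔭^k`, `a = g⁻¹k' ∈ K` diagonal).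
[cite: HarishChandra1999AdmissibleDistributions, Lemma 7.8] -/
theorem offDiag_mem_of_conj_mem_image_orbitChart (d : Fin 3 → F) {k : ℕ}
    (hsep : ∀ i j, i ≠ j → ((residueFieldCard F : ℝ≥0)⁻¹) ^ (k : ℤ) < normAbs F (d i - d j))
    (Ψ : Matrix (Fin 3) (Fin 3) F → Matrix (Fin 3) (Fin 3) F)
    (hΨ : Ψ = fun X : Matrix (Fin 3) (Fin 3) F =>
        (1 + !![0, X 0 1, X 0 2; 0, 0, X 1 2; 0, 0, 0]) * (1 + !![0, 0, 0; X 1 0, 0, 0; X 2 0, X 2 1, 0]) *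
          (Matrix.diagonal d + Matrix.diagonal (fun i => X i i)) *
          ((1 - !![0, 0, 0; X 1 0, 0, 0; X 2 0, X 2 1, 0] + !![0, 0, 0; X 1 0, 0, 0; X 2 0, X 2 1, 0] * !![0, 0, 0; X 1 0, 0, 0; X 2 0, X 2 1, 0]) *
            (1 - !![0, X 0 1, X 0 2; 0, 0, X 1 2; 0, 0, 0] + !![0, X 0 1, X 0 2; 0, 0, X 1 2; 0, 0, 0] * !![0, X 0 1, X 0 2; 0, 0, X 1 2; 0, 0, 0])))
    {z : Fin 3 → F} (hz : ∀ i, z i ∈ primePowBall F k) {k' : GL (Fin 3) F} (hk' : k' ∈ glInt 3 F)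
    (hy : (k' : Matrix (Fin 3) (Fin 3) F) * Matrix.diagonal (d + z) * ((k'⁻¹ : GL (Fin 3) F) : Matrix (Fin 3) (Fin 3) F) ∈
      Ψ '' {X : Matrix (Fin 3) (Fin 3) F | ∀ i j, X i j ∈ primePowBall F k})
    {i j : Fin 3} (hij : i ≠ j) : (k' : Matrix (Fin 3) (Fin 3) F) i j ∈ primePowBall F k := by
  obtain ⟨X, hX, -, g, hg, -, ha⟩ := exists_of_conj_mem_image_orbitChart d hsep Ψ hΨ hz k' hy
  obtain ⟨hgK, hgoff⟩ := mem_glInt_and_offDiag_of_box hX g hg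
  -- `a := g⁻¹ k' ∈ K` is diagonal, and `k' = g a`
  have haK : g⁻¹ * k' ∈ glInt 3 F := mul_mem (inv_mem hgK) hk'
  have hk'eq : (k' : Matrix (Fin 3) (Fin 3) F) = (g : Matrix (Fin 3) (Fin 3) F) * ((g⁻¹ * k' : GL (Fin 3) F) : Matrix (Fin 3) (Fin 3) F) := by
    rw [← Units.val_mul, mul_inv_cancel_left]
  rw [hk'eq, Matrix.mul_apply, Finset.sum_eq_single j (fun l _ hl => by rw [ha l j hl, mul_zero]) (fun h => absurd (Finset.mem_univ j) h)]
  have h := mul_mem_primePowBall (hgoff i j hij) (mem_primePowBall_zero_iff.2 (((mem_glInt_iff _).1 haK).1 j j))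
  rwa [add_zero] at h

/-! ## §2  The pullback theorem -/

section Pullback

variable [MeasurableSpace F] [BorelSpace F] [MeasurableSpace (GL (Fin 3) F)] [BorelSpace (GL (Fin 3) F)]
  [MeasurableSpace (Matrix (Fin 3) (Fin 3) F)] [BorelSpace (Matrix (Fin 3) (Fin 3) F)]

omit [MeasurableSpace (GL (Fin 3) F)] [BorelSpace (GL (Fin 3) F)] in
/-- `Y ↦ Y⁻¹` is Borel measurable on `M₃(F)` (`Y⁻¹ = (det Y)⁻¹ • adj Y`, inversion on the field being measurable). [folklore] -/
theorem measurable_matrix_inv : Measurable fun Y : Matrix (Fin 3) (Fin 3) F => Y⁻¹ := by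
  haveI : T2Space F := (isLocalField F).toT2Space
  haveI : SecondCountableTopology F := secondCountableTopology_localField F
  haveI : IsTopologicalRing F := inferInstance
  haveI : SecondCountableTopology (Matrix (Fin 3) (Fin 3) F) := inferInstanceAs (SecondCountableTopology (Fin 3 → Fin 3 → F))
  have h : (fun Y : Matrix (Fin 3) (Fin 3) F => Y⁻¹) = fun Y => (Y.det)⁻¹ • Y.adjugate := by
    funext Y; rw [Matrix.inv_def, Ring.inverse_eq_inv]
  rw [h]
  exact ((continuous_id.matrix_det).measurable.inv).smul (continuous_id.matrix_adjugate).measurable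

/-- **THE `K × N₃`-ORBITAL PULLBACK, UNIFORM OVER THE WEYL TRANSLATES** (see the module docstring; `hIMF` = the level-`k` product formula of ★ F2b, a hypothesis here).
[cite: HarishChandra1999AdmissibleDistributions, Lemma 7.8] [cite: HarishChandra1970, Part V §4 Lemma 22] [cite: Helgason2000, Ch. I §1 Thm. 1.14] -/
theorem lintegral_prod_indicator_image_orbitChart_eq
    (κ : Measure ↥(glInt 3 F)) [IsHaarMeasure κ] (μN : Measure ↥(unipotentRadicalGL F (id : Fin 3 → Fin 3))) [IsHaarMeasure μN]
    (μ𝔤 : Measure (Matrix (Fin 3) (Fin 3) F)) (dx : Measure F)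
    (d : Fin 3 → F) {k : ℕ} (hsep : ∀ i j, i ≠ j → ((residueFieldCard F : ℝ≥0)⁻¹) ^ (k : ℤ) < normAbs F (d i - d j))
    (Ψ : Matrix (Fin 3) (Fin 3) F → Matrix (Fin 3) (Fin 3) F)
    (hΨ : Ψ = fun X : Matrix (Fin 3) (Fin 3) F =>
        (1 + !![0, X 0 1, X 0 2; 0, 0, X 1 2; 0, 0, 0]) * (1 + !![0, 0, 0; X 1 0, 0, 0; X 2 0, X 2 1, 0]) *
          (Matrix.diagonal d + Matrix.diagonal (fun i => X i i)) *
          ((1 - !![0, 0, 0; X 1 0, 0, 0; X 2 0, X 2 1, 0] + !![0, 0, 0; X 1 0, 0, 0; X 2 0, X 2 1, 0] * !![0, 0, 0; X 1 0, 0, 0; X 2 0, X 2 1, 0]) *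
            (1 - !![0, X 0 1, X 0 2; 0, 0, X 1 2; 0, 0, 0] + !![0, X 0 1, X 0 2; 0, 0, X 1 2; 0, 0, 0] * !![0, X 0 1, X 0 2; 0, 0, X 1 2; 0, 0, 0])))
    {z : Fin 3 → F} (hz : ∀ i, z i ∈ primePowBall F k)
    (m : GL (Fin 3) F) (hm : m ∈ glInt 3 F)
    (hmA : ∀ a : GL (Fin 3) F, (∀ i j, i ≠ j → (a : Matrix (Fin 3) (Fin 3) F) i j = 0) → ∀ i j, i ≠ j → ((m * a * m⁻¹ : GL (Fin 3) F) : Matrix (Fin 3) (Fin 3) F) i j = 0)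
    {c : ℝ≥0∞}
    (hIMF : ∀ Θ : Matrix (Fin 3) (Fin 3) F → ℝ≥0∞, Measurable Θ →
      (∀ (Y : Matrix (Fin 3) (Fin 3) F) (a : Fin 3 → F), (∀ i, normAbs F (a i) = 1) → Θ (Y * Matrix.diagonal a) = Θ Y) →
      dx (primePowBall F k) ^ 3 *
          ∫⁻ k' in {k' : ↥(glInt 3 F) | ∀ i j, i ≠ j → ((k' : GL (Fin 3) F) : Matrix (Fin 3) (Fin 3) F) i j ∈ primePowBall F k},
            Θ ((k' : GL (Fin 3) F) : Matrix (Fin 3) (Fin 3) F) ∂κ =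
        c * ∫⁻ X in {X : Matrix (Fin 3) (Fin 3) F | ∀ i j, X i j ∈ primePowBall F k},
          Θ ((1 + !![0, X 0 1, X 0 2; 0, 0, X 1 2; 0, 0, 0]) * (1 + !![0, 0, 0; X 1 0, 0, 0; X 2 0, X 2 1, 0])) ∂μ𝔤)
    (h : Matrix (Fin 3) (Fin 3) F → ℝ≥0∞) (hh : Measurable h) :
    dx (primePowBall F k) ^ 3 *
        ∫⁻ q : ↥(glInt 3 F) × ↥(unipotentRadicalGL F (id : Fin 3 → Fin 3)),
          (Ψ '' {X : Matrix (Fin 3) (Fin 3) F | ∀ i j, X i j ∈ primePowBall F k}).indicator h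
            ((((q.1 : GL (Fin 3) F) * (q.2 : GL (Fin 3) F) * m : GL (Fin 3) F) : Matrix (Fin 3) (Fin 3) F) * Matrix.diagonal (d + z) *
              ((((q.1 : GL (Fin 3) F) * (q.2 : GL (Fin 3) F) * m)⁻¹ : GL (Fin 3) F) : Matrix (Fin 3) (Fin 3) F)) ∂(κ.prod μN) =
      μN {n | (n : GL (Fin 3) F) ∈ glInt 3 F} *
        (c * ∫⁻ X in {X : Matrix (Fin 3) (Fin 3) F | ∀ i j, X i j ∈ primePowBall F k},
          h (Ψ ((!![0, X 0 1, X 0 2; 0, 0, X 1 2; 0, 0, 0] : Matrix (Fin 3) (Fin 3) F) + !![0, 0, 0; X 1 0, 0, 0; X 2 0, X 2 1, 0] + Matrix.diagonal z)) ∂μ𝔤) := by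
  classical
  haveI : T2Space F := (isLocalField F).toT2Space
  haveI : LocallyCompactSpace F := (isLocalField F).toLocallyCompactSpace
  haveI : SecondCountableTopology F := secondCountableTopology_localField F
  haveI : IsTopologicalRing F := inferInstance
  haveI : T2Space (GL (Fin 3) F) := t2Space_generalLinearGroup F 3
  haveI : SecondCountableTopology (Matrix (Fin 3) (Fin 3) F) := inferInstanceAs (SecondCountableTopology (Fin 3 → Fin 3 → F))
  haveI : SecondCountableTopology (Matrix (Fin 3) (Fin 3) F)ᵐᵒᵖ := MulOpposite.opHomeomorph.symm.secondCountableTopology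
  haveI : SecondCountableTopology (GL (Fin 3) F) := Units.isEmbedding_embedProduct.secondCountableTopology
  haveI : SecondCountableTopology ↥(glInt 3 F) := TopologicalSpace.Subtype.secondCountableTopology _
  haveI : SecondCountableTopology ↥(unipotentRadicalGL F (id : Fin 3 → Fin 3)) := TopologicalSpace.Subtype.secondCountableTopology _
  haveI : BorelSpace ↥(glInt 3 F) := Subtype.borelSpace _
  haveI : BorelSpace ↥(unipotentRadicalGL F (id : Fin 3 → Fin 3)) := Subtype.borelSpace _
  haveI : BorelSpace (↥(glInt 3 F) × ↥(unipotentRadicalGL F (id : Fin 3 → Fin 3))) := Prod.borelSpace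
  haveI : LocallyCompactSpace (GL (Fin 3) F) := locallyCompactSpace_generalLinearGroup F 3
  haveI : LocallyCompactSpace ↥(unipotentRadicalGL F (id : Fin 3 → Fin 3)) :=
    (isClosed_unipotentRadicalGL (R := F) (id : Fin 3 → Fin 3)).locallyCompactSpace
  haveI : SFinite μN := inferInstance
  haveI : CompactSpace ↥(glInt 3 F) := isCompact_iff_compactSpace.1 (isCompact_glInt (n := 3) (F := F))
  haveI : IsFiniteMeasure κ := CompactSpace.isFiniteMeasure
  haveI : IsMulRightInvariant κ := Literature.MeasureTheory.Group.HaarLocalChart.isMulRightInvariant_of_isHaarMeasure κ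
  set Box : Set (Matrix (Fin 3) (Fin 3) F) := {X : Matrix (Fin 3) (Fin 3) F | ∀ i j, X i j ∈ primePowBall F k} with hBox
  set V : Set (Matrix (Fin 3) (Fin 3) F) := Ψ '' Box with hV
  set s : Matrix (Fin 3) (Fin 3) F := Matrix.diagonal (d + z) with hs
  -- measurability of the pieces
  have hΨc : Continuous Ψ := by rw [hΨ]; exact continuous_orbitChart d
  have hBox_cpt : IsCompact Box := Literature.MeasureTheory.Group.isCompact_setOf_forall_mem_primePowBall (F := F) (n := Fin 3) k
  have hBox_m : MeasurableSet Box := (Literature.MeasureTheory.Group.isOpen_setOf_forall_mem_primePowBall (F := F) (n := Fin 3) k).measurableSet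
  have hV_m : MeasurableSet V := (hBox_cpt.image hΨc).isClosed.measurableSet
  have hVh : Measurable (V.indicator h) := hh.indicator hV_m
  set Θ : Matrix (Fin 3) (Fin 3) F → ℝ≥0∞ := fun Y => V.indicator h (Y * s * Y⁻¹) with hΘ
  have hΘm : Measurable Θ := hVh.comp (((continuous_id.matrix_mul continuous_const).measurable).mul measurable_matrix_inv)
  -- right `A(𝒪)`-invariance of `Θ` (the torus centralises `s`)
  have hΘinv : ∀ (Y : Matrix (Fin 3) (Fin 3) F) (a : Fin 3 → F), (∀ i, normAbs F (a i) = 1) → Θ (Y * Matrix.diagonal a) = Θ Y := by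
    intro Y a ha
    have ha0 : ∀ i, a i ≠ 0 := fun i h0 => by have h1 := ha i; rw [h0, map_zero] at h1; exact zero_ne_one h1
    have hdet : IsUnit (Matrix.diagonal a).det := by
      rw [Matrix.det_diagonal, isUnit_iff_ne_zero]; exact Finset.prod_ne_zero_iff.2 fun i _ => ha0 i
    have hcomm : Matrix.diagonal a * s = s * Matrix.diagonal a := by
      rw [hs, Matrix.diagonal_mul_diagonal, Matrix.diagonal_mul_diagonal]; congr 1; funext i; exact mul_comm _ _
    have h1 : Y * Matrix.diagonal a * s * (Y * Matrix.diagonal a)⁻¹ = Y * (Matrix.diagonal a * s * (Matrix.diagonal a)⁻¹) * Y⁻¹ := by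
      rw [Matrix.mul_inv_rev]; simp only [Matrix.mul_assoc]
    simp only [hΘ]
    rw [h1, hcomm, Matrix.mul_nonsing_inv_cancel_right _ _ hdet]
  -- the integrand in terms of `Θ`
  have hΘy : Measurable fun q : ↥(glInt 3 F) × ↥(unipotentRadicalGL F (id : Fin 3 → Fin 3)) =>
      Θ ((((q.1 : GL (Fin 3) F) * (q.2 : GL (Fin 3) F) * m : GL (Fin 3) F)) : Matrix (Fin 3) (Fin 3) F) :=
    hΘm.comp (Units.continuous_val.comp ((((continuous_subtype_val.comp continuous_fst).mul
      (continuous_subtype_val.comp continuous_snd)).mul continuous_const))).measurable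
  have hcongr : ∫⁻ q : ↥(glInt 3 F) × ↥(unipotentRadicalGL F (id : Fin 3 → Fin 3)),
        V.indicator h ((((q.1 : GL (Fin 3) F) * (q.2 : GL (Fin 3) F) * m : GL (Fin 3) F) : Matrix (Fin 3) (Fin 3) F) * s *
          ((((q.1 : GL (Fin 3) F) * (q.2 : GL (Fin 3) F) * m)⁻¹ : GL (Fin 3) F) : Matrix (Fin 3) (Fin 3) F)) ∂(κ.prod μN) =
      ∫⁻ q : ↥(glInt 3 F) × ↥(unipotentRadicalGL F (id : Fin 3 → Fin 3)),
        Θ ((((q.1 : GL (Fin 3) F) * (q.2 : GL (Fin 3) F) * m : GL (Fin 3) F)) : Matrix (Fin 3) (Fin 3) F) ∂(κ.prod μN) :=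
    lintegral_congr fun q => by simp only [hΘ, Matrix.coe_units_inv]
  rw [hcongr, lintegral_prod_symm _ hΘy.aemeasurable]
  -- the inner `K`-integral: `I₀` on `N(𝒪)`, `0` off it
  set I₀ : ℝ≥0∞ := ∫⁻ k' : ↥(glInt 3 F), Θ ((k' : GL (Fin 3) F) : Matrix (Fin 3) (Fin 3) F) ∂κ with hI₀
  set S : Set ↥(unipotentRadicalGL F (id : Fin 3 → Fin 3)) := {n | (n : GL (Fin 3) F) ∈ glInt 3 F} with hS
  have hS_m : MeasurableSet S := measurable_subtype_coe (isOpen_glInt 3 F).measurableSet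
  have hinner : ∀ n : ↥(unipotentRadicalGL F (id : Fin 3 → Fin 3)),
      ∫⁻ k' : ↥(glInt 3 F), Θ ((((k' : GL (Fin 3) F) * (n : GL (Fin 3) F) * m : GL (Fin 3) F)) : Matrix (Fin 3) (Fin 3) F) ∂κ =
        S.indicator (fun _ => I₀) n := by
    intro n
    by_cases hn : (n : GL (Fin 3) F) ∈ glInt 3 F
    · rw [Set.indicator_of_mem (show n ∈ S from hn)]
      have hj : (n : GL (Fin 3) F) * m ∈ glInt 3 F := mul_mem hn hm
      have hfun : (fun k' : ↥(glInt 3 F) => Θ ((((k' : GL (Fin 3) F) * (n : GL (Fin 3) F) * m : GL (Fin 3) F)) : Matrix (Fin 3) (Fin 3) F)) =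
          fun k' => (fun k'' : ↥(glInt 3 F) => Θ ((k'' : GL (Fin 3) F) : Matrix (Fin 3) (Fin 3) F)) (k' * ⟨(n : GL (Fin 3) F) * m, hj⟩) := by
        funext k'; simp only [Subgroup.coe_mul, mul_assoc]
      rw [hfun]
      exact lintegral_mul_right_eq_self (fun k'' : ↥(glInt 3 F) => Θ ((k'' : GL (Fin 3) F) : Matrix (Fin 3) (Fin 3) F)) _
    · rw [Set.indicator_of_notMem (show n ∉ S from hn)]
      have h0 : ∀ k' : ↥(glInt 3 F), Θ ((((k' : GL (Fin 3) F) * (n : GL (Fin 3) F) * m : GL (Fin 3) F)) : Matrix (Fin 3) (Fin 3) F) = 0 := by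
        intro k'
        simp only [hΘ]
        refine Set.indicator_of_notMem (fun hyV => hn ?_) _
        rw [← Matrix.coe_units_inv] at hyV
        exact mem_glInt_of_conj_mem_image_orbitChart d hsep Ψ hΨ hz k'.2 n.2 hm hmA hyV
      simp only [h0, lintegral_zero]
  simp_rw [hinner]
  rw [lintegral_indicator_const hS_m]
  -- `I₀` lives on the congruence set `C_k`
  set C : Set ↥(glInt 3 F) := {k' : ↥(glInt 3 F) | ∀ i j, i ≠ j → ((k' : GL (Fin 3) F) : Matrix (Fin 3) (Fin 3) F) i j ∈ primePowBall F k} with hC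
  have hC_m : MeasurableSet C := by
    have hCeq : C = ⋂ (i : Fin 3) (j : Fin 3) (_ : i ≠ j),
        (fun k' : ↥(glInt 3 F) => ((k' : GL (Fin 3) F) : Matrix (Fin 3) (Fin 3) F) i j) ⁻¹' (primePowBall F k : Set F) := by
      ext k'; simp only [hC, Set.mem_setOf_eq, Set.mem_iInter, Set.mem_preimage]
    rw [hCeq]
    exact MeasurableSet.iInter fun i => MeasurableSet.iInter fun j => MeasurableSet.iInter fun _ =>
      ((Units.continuous_val.comp continuous_subtype_val).matrix_elem i j).measurable (measurableSet_primePowBall (F := F) k)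
  have hI₀C : I₀ = ∫⁻ k' in C, Θ ((k' : GL (Fin 3) F) : Matrix (Fin 3) (Fin 3) F) ∂κ := by
    rw [hI₀, ← lintegral_indicator hC_m]
    refine lintegral_congr fun k' => ?_
    by_cases hk'C : k' ∈ C
    · exact (Set.indicator_of_mem hk'C (fun k' : ↥(glInt 3 F) => Θ ((k' : GL (Fin 3) F) : Matrix (Fin 3) (Fin 3) F))).symm
    · rw [Set.indicator_of_notMem hk'C]
      simp only [hΘ]
      refine Set.indicator_of_notMem (fun hyV => hk'C ?_) _
      rw [← Matrix.coe_units_inv] at hyV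
      exact fun i j hij => offDiag_mem_of_conj_mem_image_orbitChart d hsep Ψ hΨ hz k'.2 hyV hij
  -- pointwise identification of the chart-side integrand
  have hchart : ∫⁻ X in Box, Θ ((1 + !![0, X 0 1, X 0 2; 0, 0, X 1 2; 0, 0, 0]) * (1 + !![0, 0, 0; X 1 0, 0, 0; X 2 0, X 2 1, 0])) ∂μ𝔤 =
      ∫⁻ X in Box, h (Ψ ((!![0, X 0 1, X 0 2; 0, 0, X 1 2; 0, 0, 0] : Matrix (Fin 3) (Fin 3) F) + !![0, 0, 0; X 1 0, 0, 0; X 2 0, X 2 1, 0] +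
        Matrix.diagonal z)) ∂μ𝔤 := by
    refine setLIntegral_congr_fun hBox_m (fun X hX => ?_)
    set X' : Matrix (Fin 3) (Fin 3) F := (!![0, X 0 1, X 0 2; 0, 0, X 1 2; 0, 0, 0] : Matrix (Fin 3) (Fin 3) F) +
      !![0, 0, 0; X 1 0, 0, 0; X 2 0, X 2 1, 0] + Matrix.diagonal z with hX'
    have hU' : (!![0, X' 0 1, X' 0 2; 0, 0, X' 1 2; 0, 0, 0] : Matrix (Fin 3) (Fin 3) F) = !![0, X 0 1, X 0 2; 0, 0, X 1 2; 0, 0, 0] := by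
      rw [hX']; ext i j; fin_cases i <;> fin_cases j <;> simp
    have hL' : (!![0, 0, 0; X' 1 0, 0, 0; X' 2 0, X' 2 1, 0] : Matrix (Fin 3) (Fin 3) F) = !![0, 0, 0; X 1 0, 0, 0; X 2 0, X 2 1, 0] := by
      rw [hX']; ext i j; fin_cases i <;> fin_cases j <;> simp
    have hD' : (fun i => X' i i) = z := by
      rw [hX']; funext i; fin_cases i <;> simp
    have hX'Box : X' ∈ Box := by
      rw [hBox, Set.mem_setOf_eq, hX']
      intro i j
      fin_cases i <;> fin_cases j <;> simp [hX _ _, hz]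
    obtain ⟨g, hg, hconj⟩ := exists_orbitChart_eq_conj d X'
    have hΨX' : Ψ X' = (g : Matrix (Fin 3) (Fin 3) F) * s * (g : Matrix (Fin 3) (Fin 3) F)⁻¹ := by
      rw [hs, ← hD', ← Matrix.coe_units_inv, ← hconj, hΨ]
    rw [hU', hL'] at hg
    simp only [hΘ]
    rw [← hg, ← hΨX', Set.indicator_of_mem (Set.mem_image_of_mem Ψ hX'Box)]
  -- assemble
  rw [hI₀C] at *
  calc dx (primePowBall F k) ^ 3 * ((∫⁻ k' in C, Θ ((k' : GL (Fin 3) F) : Matrix (Fin 3) (Fin 3) F) ∂κ) * μN S)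
      = μN S * (dx (primePowBall F k) ^ 3 * ∫⁻ k' in C, Θ ((k' : GL (Fin 3) F) : Matrix (Fin 3) (Fin 3) F) ∂κ) := by ring
    _ = μN S * (c * ∫⁻ X in Box, h (Ψ ((!![0, X 0 1, X 0 2; 0, 0, X 1 2; 0, 0, 0] : Matrix (Fin 3) (Fin 3) F) +
          !![0, 0, 0; X 1 0, 0, 0; X 2 0, X 2 1, 0] + Matrix.diagonal z)) ∂μ𝔤) := by rw [hIMF Θ hΘm hΘinv, hchart]

end Pullback

end Summit.HodgeConjecture.HodgeConjecture.Cruxes.H413.K2E3GL3KNOrbitalLocalPullback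

end
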